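import Summits.HodgeConjecture.HodgeConjecture.Theses.EndoscopicMiddleDegree
import Literature.AlgebraicGeometry.ShimuraVarieties.HeckeCorrespondenceAction
import Summits.HodgeConjecture.HodgeConjecture.Theorems.EndoscopicMiddleDegreeAlgebraicOrEnvelopedStubHeckeGraphAlgebraic
import Summits.HodgeConjecture.HodgeConjecture.Theorems.EndoscopicMiddleDegreeIsotypicMiddleClassesAlgebraicStubCorrActionAlgebraic
import Summits.HodgeConjecture.HodgeConjecture.Theorems.EndoscopicMiddleDegreeOrthogonalEnvelopedHeckeHodgeType
import Summits.HodgeConjecture.HodgeConjecture.Theorems.EndoscopicMiddleDegreeOrthogonalSplitOfFacts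

/-!
# Crux `IsotypicMiddleClassesAlgebraic` (stmt-HodgeConjecture-14301) — line `hecke-generation`
(crux-strategist `planner-cstrat-stmt-HodgeConjecture-14301-p1-0`, wall-breaker generation 1, 2026-08-17)

The crux: for an orientation family `μ` with Poincaré duality, `m ∈ {1,2}` (`dim X = 2n`, `n = m+1`),
a datum `D : UnitaryBallQuotientDatum (2n) X`, an algebraic `γ ∈ N^{2n} H^{4n}((X ⊗ X)(ℂ))` whose
action `P = γ_*` (H2) preserves rational classes and (H3) has purely `(n,n)` image: every rational `c`
with `P c = c` is algebraic.

THE LINE (first line on this crux that uses the AUTOMORPHIC SYMMETRY of `X` on the SUPPLY side; it is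
enabled by vocabulary that landed on 2026-08-16 for the sibling crux `OrthogonalEnveloped`: the Hecke
operators `T_g = D.heckeCorrespondenceAction k g` (Literature `ShimuraVarieties/HeckeCorrespondenceAction`),
their algebraicity as correspondence actions (`stub_heckeGraphAlgebraic`, p-landed), the Hecke ring
(`heckeMul_mem_span`) and Hodge-type preservation (`heckeHodgeType`)). Write `𝓗 = 𝓗(D)` for the
ℂ-algebra generated by the `T_g` on `H^{2n}(X(ℂ); ℂ)`, `TW(D)` for the theta world of `OrthogonalSplit`,
`TWH(D) = 𝓗 · TW(D)` for its Hecke saturation, and `K(D)` for the HECKE KERNEL: the rational Hodge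
`(n,n)`-classes cup-orthogonal to `TWH(D)`. Algebraic classes `Alg = Nⁿ H²ⁿ` are `𝓗`-stable
(`T_g = (γ_g)_*` with `γ_g` algebraic, and algebraic correspondences preserve `Alg` given the route
support `CupProductAlgebraic`), rational classes and Hodge types are `𝓗`-stable, and the cup form is
`ℚ`-anisotropic on `K(D)` (Hodge–Riemann: `K(D)` is primitive because `TW ⊇ Hdg^{m,m}_ℚ ∪ N¹`). Hence:

  **Hecke generation.** If every `ℚ`-irreducible `𝓗`-stable piece `M` of `span K(D)` is MET by one
  algebraic class (`∃ a ∈ Alg, ∃ x ∈ M, a ∪ x ≠ 0`), then every rational Hodge `(n,n)`-class of `X` is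
  algebraic (`stub_heckeKernelGeneration`, the ENGINE: the `𝓗`-stable rational subspace
  `C = {x ∈ K : x ⊥ Alg}` must vanish, and `K ⊥⊥`-duality inside the anisotropic `K_ℚ` turns
  "detected" into "algebraic"), whence the crux (Disproof F1: `c = P c` is a rational `(n,n)`-class).

Compared with the landed reformulation DETECT (p112589: one algebraic class per non-zero CLASS, i.e. a
SPANNING family of seeds) the residue `stub_oneSeedPerHeckePiece` asks for a GENERATING family of seeds
under the Hecke algebra: for a multiplicity-one piece (Mok / KMSW multiplicity one for `U(N)`), ONE
algebraic cycle, at ANY level (the `T_g` include all level-changing averages), with ONE non-zero period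
against the piece. This is the exact shape every proposed supply plugs into (p-adic ✓-type seeds of the
route's SupersingularSeeds, tautological classes of Deligne–Mostow families, exotic divisors on covers):
one class per invisible Galois orbit of automorphic representations, not a basis.

HONEST STATUS (strategist's self-critic, recorded so that the lead does not re-learn it): modulo the
other four stubs (all provable now or printed theorems) `stub_oneSeedPerHeckePiece` is EQUIVALENT to
middle-degree HC on the sector (HC ⟹ it: take `a = x`; it ⟹ HC: this file), exactly as DETECT is; it is
not refutable short of `¬HC` (Negative/NoKillShortOfHC p80796) and, over an abstract datum, no detecting
class is constructible today (Disproof F0; special cycles and the geodesic divisor ring are blind on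
`K(D)` by definition resp. by `DivisorialInvisibility` / TRIAGE-r2-3 App. A). Its value is the REDUCTION
(spanning ⟶ Hecke-generating), which is new formal content; the expected lead report after landing
stubs 1–4 is `dead on supply at stub_oneSeedPerHeckePiece` unless a seed source is typed meanwhile.

* `stub_lowDegreeHodge` (S1, PRINTED THEOREMS, literature-grade): HC in degree `2m` on the sector —
  Lefschetz `(1,1)` for `m = 1` (named fact `lefschetzOneOne_rational`), BMM arXiv:1306.1515 Thm 4 /
  Cor. 62 in degree 4 on compact `U(6,1)` quotients for `m = 2` (`3(a+b)+|a−b| = 12 < 14`). It is the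
  hypothesis of the route's TARGET `MiddleDegreeStep`, which the crux as cut does not carry.
* `stub_saturatedThetaWorldAlgebraic` (S2, provable now): `S1 → CupProductAlgebraic → TWH(D) ≤ Alg`
  (special cycles and cycles-on-special-cycles by `classesSupportedOn_le_supportedClasses` with the
  datum's codimension fields; the Lefschetz summand by S1 + `CupProductAlgebraic`; the saturation by
  `stub_heckeGraphAlgebraic` + `stub_corrActionAlgebraic` + `Algebra.adjoin_induction`).
* `stub_heckeAdjoint` (S3, topology, provable now): the cup-adjoint of `T_g` lies in `𝓗`
  (`T_g^† = c_g · T_{g⁻¹}`: transfer is adjoint to pull-back; common deep normal level as in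
  `heckeMul_mem_span`).
* `stub_heckeKernelGeneration` (S4, THE ENGINE, provable now from `mem_sup_span_orthogonal`,
  `hodgeClass_eq_zero_of_cup_orthogonal`, `finite_complexBetti`, `heckeHodgeType`,
  `isRationalClass_heckeCorrespondenceAction`, the RationalFixed lemmas p80943).
* `stub_oneSeedPerHeckePiece` (S5, THE BET = HECKE-DETECT).
* `isotypicMiddleClassesAlgebraic_of (h9 : CupProductAlgebraic)` — the kernel-checked composition,
  concluding the crux BY NAME.
-/

noncomputable section

namespace Summit.HodgeConjecture.HodgeConjecture.Cruxes.IsotypicMiddleClassesAlgebraic.HeckeGeneration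

set_option linter.dupNamespace false

open CategoryTheory MonoidalCategory CartesianMonoidalCategory
open Literature.AlgebraicGeometry Literature.AlgebraicGeometry.HodgeTheory
open Literature.AlgebraicGeometry.Motives
open Literature.AlgebraicGeometry.ShimuraVarieties Literature.AlgebraicTopology.SingularHomology
open Summit.HodgeConjecture.HodgeConjecture.Theses

variable {m : ℕ} {X : SchemeOver ℂ}

/-! ### Vocabulary: Hecke algebra, theta world, Hecke saturation, Hecke kernel, rational pieces -/

/-- The HECKE ALGEBRA `𝓗(D)` on `H^{2n}(X(ℂ); ℂ)`, `n = m+1`: the `ℂ`-subalgebra of `End H^{2n}` generated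
by the Hecke operators `T_g` (`D.heckeCorrespondenceAction`), exactly the algebra of `heckeHodgeType`
and `adjoin_hecke_le_span` (= the `ℂ`-span of the `T_g`, Hecke ring). -/
def heckeAlgebra (D : UnitaryBallQuotientDatum (2 * (m + 1)) X) :
    Subalgebra ℂ (Module.End ℂ (complexBetti X (2 * (m + 1)))) :=
  Algebra.adjoin ℂ (Set.range (D.heckeCorrespondenceAction (2 * (m + 1))))

/-- The THETA WORLD `TW(D) = SCⁿ(D) ⊔ SCon(D) ⊔ span{a ∪ d : a ∈ Hdg^{m,m}_ℚ, d ∈ N¹}` — verbatim the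
subspace of the route items `OrthogonalSplit` / `OrthogonalEnveloped`. -/
def thetaWorld (m : ℕ) (X : SchemeOver ℂ) (D : UnitaryBallQuotientDatum (2 * (m + 1)) X) :
    Submodule ℂ (complexBetti X (2 * (m + 1))) :=
  ((⨆ (W : Submodule D.E (Fin (2 * (m + 1) + 1) → D.E))
      (_ : IsTotallyPositive (conjRingHom D.E) D.H W) (_ : Module.finrank D.E W = m + 1),
      classesSupportedOn X (D.specialSubvariety W) (2 * (m + 1))) ⊔
    (⨆ (W : Submodule D.E (Fin (2 * (m + 1) + 1) → D.E))
      (_ : IsTotallyPositive (conjRingHom D.E) D.H W) (_ : Module.finrank D.E W = m)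
      (Z : Set X.left) (_ : IsClosed Z) (_ : Z ⊆ D.specialSubvariety W)
      (_ : ∀ z ∈ Z, ((m + 1 : ℕ) : ℕ∞) ≤ Order.coheight z),
      classesSupportedOn X Z (2 * (m + 1))) ⊔
    Submodule.span ℂ {z : complexBetti X (2 * (m + 1)) | ∃ a : complexBetti X (2 * m),
      IsRationalClass a ∧ IsOfHodgeType (2 * (m + 1)) X (2 * m) m m a ∧
      ∃ d ∈ algebraicClasses X 1, z = cupProduct (two_mul_add_two_mul m 1) a d})

/-- The HECKE SATURATION `TWH(D) = 𝓗(D) · TW(D)` of the theta world (it contains `TW(D)`: `1 ∈ 𝓗`). -/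
def heckeSaturatedThetaWorld (m : ℕ) (X : SchemeOver ℂ) (D : UnitaryBallQuotientDatum (2 * (m + 1)) X) :
    Submodule ℂ (complexBetti X (2 * (m + 1))) :=
  Submodule.span ℂ {x | ∃ a ∈ heckeAlgebra D, ∃ w ∈ thetaWorld m X D, x = a w}

/-- The HECKE KERNEL `K(D)`: rational Hodge `(n,n)`-classes cup-orthogonal to the Hecke-saturated theta
world. On paper (BMM + Gan–Ichino + Kudla–Millson) its span is the sum of the theta-INVISIBLE Tate-type
(and core) Hecke pieces — the `ε(½) = −1` classes (route text, triage r1-3 of `MiddleThetaSpan`). -/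
def heckeKernel (m : ℕ) (X : SchemeOver ℂ) (D : UnitaryBallQuotientDatum (2 * (m + 1)) X) :
    Set (complexBetti X (2 * (m + 1))) :=
  {e | IsRationalClass e ∧ IsOfHodgeType (2 * (m + 1)) X (2 * (m + 1)) (m + 1) (m + 1) e ∧
    ∀ x ∈ heckeSaturatedThetaWorld m X D, cupProduct (two_mul_add_two_mul (m + 1) (m + 1)) e x = 0}

/-! ### Shapes used below (prose; the statements are inlined so that every registered stub is self-contained)

* RATIONALLY GENERATED subspace `M`: `M ≤ span_ℂ {x ∈ M | IsRationalClass x}` (`M = M_ℚ ⊗ ℂ`).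
* HECKE-STABLE subspace `M`: `∀ g, T_g M ⊆ M`.
* `ℚ`-IRREDUCIBLE HECKE PIECE OF THE KERNEL: `M ≤ span K(D)`, rationally generated, Hecke-stable, `M ≠ ⊥`,
  and every rationally generated Hecke-stable `M' ≤ M` is `⊥` or `M` (on paper: one Galois orbit of
  theta-invisible automorphic representations `A(n,n) ⊗ σ(π_f)` with its multiplicity space).
* HECKE-DETECT for `D`: every such piece `M` is MET by an algebraic class: `∃ a ∈ Alg, ∃ x ∈ M, a ∪ x ≠ 0`.
* HECKE ADJOINTS for `D`: `∀ g, ∃ a ∈ 𝓗(D), ∀ x y, (T_g x) ∪ y = x ∪ (a y)`.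
* MIDDLE HC for `D`: every rational Hodge `(n,n)`-class of `X` is algebraic (Disproof `MiddleHC`, instance `D`).
-/

/-! ### S1 — HC one degree down on the sector (printed theorems: Lefschetz (1,1) / BMM in degree 4) -/

/-- **S1 (`stub_lowDegreeHodge`, LITERATURE).** On `X` carrying a `UnitaryBallQuotientDatum (2(m+1)) X`,
`m ∈ {1,2}`, every rational Hodge `(m,m)`-class in `H^{2m}(X(ℂ); ℂ)` is algebraic: `m = 1` is Lefschetz
`(1,1)` (tree: named fact `lefschetzOneOne_rational`, Voisin I Thm 7.2 / 11.30); `m = 2` is BMM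
arXiv:1306.1515 Thm 4 + Cor. 62 in degree 4 on compact `U(6,1)` quotients (`(a,b) = (2,2)`,
`3(a+b)+|a−b| = 12 < 2(p+1) = 14`): special cycles with `(1,1)`-coefficients span `H^{2,2}`, defined
over `ℚ`. Exactly the hypothesis of the route target `MiddleDegreeStep`; the crux as cut omits it, this
line needs it for the Lefschetz summand of the theta world. Why plausibly true: it is printed. Size: L
(`m = 1`, modulo the named fact) / XL-literature (`m = 2`, to be vendored as a named fact).
[cite: BergeronMillsonMoeglin2016Balls, Thm 4 and Cor. 62] [cite: VoisinHodgeI2002, Thm 11.30] -/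
theorem stub_lowDegreeHodge (m : ℕ) (X : SchemeOver ℂ) (D : UnitaryBallQuotientDatum (2 * (m + 1)) X)
    (h1 : 1 ≤ m) (h2 : m ≤ 2) (a : complexBetti X (2 * m)) (ha : IsRationalClass a)
    (haH : IsOfHodgeType (2 * (m + 1)) X (2 * m) m m a) : a ∈ algebraicClasses X m := by
  sorry

/-! ### S2 — the Hecke-saturated theta world is algebraic -/

/-- **S2 (`stub_saturatedThetaWorldAlgebraic`, provable now).** Granted S1 for `D` and the route support
`CupProductAlgebraic` (stmt-HodgeConjecture-14350), `TWH(D) ≤ algebraicClasses X (m+1)`: `SCⁿ(D)` and the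
cycles-on-special-cycles summand by `classesSupportedOn_le_supportedClasses` with the datum's fields
`isClosed_specialSubvariety`, `le_coheight_of_mem_specialSubvariety` (as in the landed
`algebraicOrEnvelopedOfSplit_proof`); the Lefschetz summand `a ∪ d` by S1 + `CupProductAlgebraic`; then
`a w ∈ Alg` for `a ∈ 𝓗(D)` by `Algebra.adjoin_induction`, `stub_heckeGraphAlgebraic` (`T_g = (γ_g)_*`,
`γ_g` algebraic, p-landed for the sibling crux) and `stub_corrActionAlgebraic` (p88732). Size: M. -/
theorem stub_saturatedThetaWorldAlgebraic (h9 : EndoscopicMiddleDegree.CupProductAlgebraic)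
    (μ : OrientationFamily) (hμ : μ.HasPoincareDuality)
    (m : ℕ) (X : SchemeOver ℂ) (D : UnitaryBallQuotientDatum (2 * (m + 1)) X) (h1 : 1 ≤ m) (h2 : m ≤ 2)
    (hlow : ∀ a : complexBetti X (2 * m), IsRationalClass a →
        IsOfHodgeType (2 * (m + 1)) X (2 * m) m m a → a ∈ algebraicClasses X m) :
    heckeSaturatedThetaWorld m X D ≤ algebraicClasses X (m + 1) := by
  sorry

/-! ### S3 — Hecke operators have Hecke adjoints -/

/-- **S3 (`stub_heckeAdjoint`, topology, provable now).** For every `g` there is `a ∈ 𝓗(D)` with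
`(T_g x) ∪ y = x ∪ (a y)` in `H^{4n}(X(ℂ); ℂ)` for all `x, y ∈ H^{2n}`: for non-admissible `g`, `T_g = 0`
and `a = 0`; for admissible `g`, `a = c_g • T_{g⁻¹}` (`g⁻¹ ∈ U(V)(F)` is admissible by the landed
`isHeckeAdmissible_of_mem_unitaryGroup`): on a common deep normal level `M ⊴ Γ` (landed
`stub_exists_deepLevel`), `π_M^*` is injective on `H^{4n}` too, the transfer is adjoint to pull-back
(`τ(α) ∪ β ↤ α ∪ π^*β`, Hatcher §3.G), and `Σ_q ⟨(g q)^* x, y⟩ = Σ_q ⟨x, ((g q)⁻¹)^* y⟩` upstairs because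
each `v ↦ g q v` induces a homeomorphism of the level-`M` cover of degree one. Why plausibly true: standard
(`T_g` and `T_{g⁻¹}` are adjoint for the cup / Petersson pairing, Shimura §3.4). Size: M–L
(deck-transformation bookkeeping as in `heckeMul_mem_span`). -/
theorem stub_heckeAdjoint (m : ℕ) (X : SchemeOver ℂ) (D : UnitaryBallQuotientDatum (2 * (m + 1)) X)
    (h1 : 1 ≤ m) (h2 : m ≤ 2) :
    ∀ g, ∃ a ∈ heckeAlgebra D, ∀ x y : complexBetti X (2 * (m + 1)),
      cupProduct (two_mul_add_two_mul (m + 1) (m + 1)) (D.heckeCorrespondenceAction (2 * (m + 1)) g x) y = cupProduct (two_mul_add_two_mul (m + 1) (m + 1)) x (a y) := by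
  sorry

/-! ### S4 — THE ENGINE: Hecke generation of the kernel -/

/-- **S4 (`stub_heckeKernelGeneration`, THE ENGINE, provable now).** For a datum `D` with
(i) HECKE-DETECT, (ii) `TWH(D) ≤ Alg` (S2) and (iii) Hecke adjoints (S3), every rational Hodge
`(n,n)`-class of `X` is algebraic. Proof on paper (all inputs landed): let `A = span{rational algebraic
classes}` (`Alg` is rationally generated: supported classes are spanned by rational supported classes,
`ker_restrictCompl_le_span`; algebraic classes are Hodge classes,
`isOfHodgeType_of_mem_algebraicClasses_of_isSmoothProjective`), `K = K(D)`,
`C = {x ∈ K : x ∪ a = 0 ∀ a ∈ A}`. (a) `TWH(D)` satisfies (T1) (spanned by rational Hodge classes: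
`isRationalClass_heckeCorrespondenceAction`, `heckeHodgeType`) and (T2) (contains `b ∪ d`), so
`mem_sup_span_orthogonal` (Theorems/EndoscopicMiddleDegreeOrthogonalSplit, with
`hardLefschetz_hodgeRiemann_holds`) splits every rational Hodge `(n,n)`-class as `t + k`, `t ∈ TWH(D)`,
`k ∈ K`, and `hodgeClass_eq_zero_of_cup_orthogonal` makes the cup form `ℚ`-ANISOTROPIC on `K`
(`k ∪ k = 0 ⟹ k = 0`, since `K ⊥ TW ⊇ Hdg^{m,m}_ℚ ∪ N¹`). (b) `span C` is rationally generated and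
Hecke-stable (adjoints (iii); `A`, `TWH`, rationality and Hodge type are `𝓗`-stable), so if `C ≠ 0` a
minimal non-zero rationally generated Hecke-stable `M ≤ span C` exists (`finite_complexBetti`) and is a
`ℚ`-irreducible Hecke piece of the kernel; (i) gives `a ∈ Alg`, `x ∈ M` with `a ∪ x ≠ 0`, w.l.o.g. `a`
rational, i.e. `a ∈ A ⊥ span C ∋ x` — contradiction. (c) So `C = 0`: every non-zero `x ∈ K` pairs
non-trivially with some rational algebraic `a = t + k_a`, hence with `k_a = a − t ∈ A ∩ K` (`t ∈ TWH ≤ Alg`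
by (ii), `x ⊥ t`); so `K_ℚ → Hom_ℚ((A ∩ K)_ℚ, ℚ)` is injective, `dim_ℚ K_ℚ ≤ dim_ℚ (A ∩ K)_ℚ`, and
`A ∩ K = K` (rational coordinates: `exists_rat_coords`, `linearIndependent_iff_of_isRationalClass`, the
RationalFixed lemmas p80943); with (ii) again `t + k ∈ Alg`. The route support `CupProductAlgebraic` (`h9`,
stmt-HodgeConjecture-14350) enters only through the `𝓗`-stability of `Alg`: `T_g = (γ_g)_*` for an algebraic `γ_g`
(`stub_heckeGraphAlgebraic`, at the complex orientation family, Poincaré duality being the theorem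
`OrientationFamily.hasPoincareDuality`) and `stub_corrActionAlgebraic h9`; a Hodge model of `X` for
`mem_sup_span_orthogonal` comes from the landed `curveNetMordellWeil_hodgeModels_proof`. Size: L. -/
theorem stub_heckeKernelGeneration (h9 : EndoscopicMiddleDegree.CupProductAlgebraic) (m : ℕ) (X : SchemeOver ℂ)
    (D : UnitaryBallQuotientDatum (2 * (m + 1)) X) (h1 : 1 ≤ m) (h2 : m ≤ 2)
    (hdet : ∀ M : Submodule ℂ (complexBetti X (2 * (m + 1))),
      M ≤ Submodule.span ℂ (heckeKernel m X D) → M ≤ Submodule.span ℂ {x | x ∈ M ∧ IsRationalClass x} →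
      (∀ g, ∀ x ∈ M, D.heckeCorrespondenceAction (2 * (m + 1)) g x ∈ M) → M ≠ ⊥ →
      (∀ M' : Submodule ℂ (complexBetti X (2 * (m + 1))), M' ≤ M →
        M' ≤ Submodule.span ℂ {x | x ∈ M' ∧ IsRationalClass x} → (∀ g, ∀ x ∈ M', D.heckeCorrespondenceAction (2 * (m + 1)) g x ∈ M') → M' = ⊥ ∨ M' = M) →
      ∃ a ∈ algebraicClasses X (m + 1), ∃ x ∈ M, cupProduct (two_mul_add_two_mul (m + 1) (m + 1)) a x ≠ 0)
    (hTWH : heckeSaturatedThetaWorld m X D ≤ algebraicClasses X (m + 1))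
    (hadj : ∀ g, ∃ a ∈ heckeAlgebra D, ∀ x y : complexBetti X (2 * (m + 1)),
      cupProduct (two_mul_add_two_mul (m + 1) (m + 1)) (D.heckeCorrespondenceAction (2 * (m + 1)) g x) y = cupProduct (two_mul_add_two_mul (m + 1) (m + 1)) x (a y)) :
    ∀ c : complexBetti X (2 * (m + 1)), IsRationalClass c →
      IsOfHodgeType (2 * (m + 1)) X (2 * (m + 1)) (m + 1) (m + 1) c → c ∈ algebraicClasses X (m + 1) := by
  sorry

/-! ### S5 — THE BET: one seed per irreducible Hecke piece of the kernel (HECKE-DETECT) -/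

/-- **S5 (`stub_oneSeedPerHeckePiece`, THE BET).** For `m ∈ {1,2}`, a datum `D` and a `ℚ`-irreducible
Hecke piece `M` of the Hecke kernel `K(D)` (`M ≤ span K(D)`, rationally generated, Hecke-stable, `M ≠ ⊥`,
no proper non-zero rationally generated Hecke-stable subspace) there is ONE algebraic class
`a ∈ Nⁿ H²ⁿ(X(ℂ))` and ONE `x ∈ M` with `a ∪ x ≠ 0`. On paper `M = ⊕_σ H^{n,n}[σπ_f]` over one Galois
orbit of theta-INVISIBLE cohomological representations (`ε(½, Ψ'×χ₀⁻¹) = −1`: tempered Tate type or the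
GL₂-CAP `(ρ⊠R₂)⊞χ₀`; cores if any), and by the irreducibility ONE period `∫_Z ω_φ ≠ 0` for ONE cycle `Z`
at ANY level and ONE vector `φ` of the orbit suffices (Hecke translates then generate `M`). Why it might
fail: only with HC (HC ⟹ S5 with `a = x`, anisotropy on `K`); why it is hard: no cycle functorially
attached to the Shimura datum meets `K(D)` — special cycles by theta dichotomy, the geodesic divisor ring
of every étale level by `DivisorialInvisibility` / TRIAGE-r2-3 App. A, GGP-type diagonal cycles through the
codimension-`m` special cycles `c(W)` because kernel classes RESTRICT TO ZERO there (`ι^*e = Lᵐ d₀`, `d₀ ∈ NS(c(W))_ℚ`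
by hard Lefschetz + Lefschetz (1,1) on the `(n+1)`-fold `c(W)`, and `⟨ι^*e, d⟩ = ⟨e, ι_*d⟩ = 0` for `d ∈ NS(c(W))`
since `ι_*d` is a cycle on a special cycle; Hodge index forces `d₀ = 0` — STRATEGY-CENSUS.md §Negation (iii))
— so the seed must be a NON-equivariant cycle (candidate sources in STRATEGY-CENSUS.md: p-adic ✓-type
seeds via BEK + ALG; `κ₂` of the universal `μ_d`-curve on Deligne–Mostow data; exotic divisors on branched
covers). H3 of the crux is honoured through `heckeKernel` (only `(n,n)`-classes are asked about; Disproof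
F3(a)); no landed `Negative/*` lemma refutes an instance (they concern the crux's own hypotheses).
Size: open problem (= HC for the invisible pieces, ONE class per Galois orbit instead of a basis). -/
theorem stub_oneSeedPerHeckePiece (m : ℕ) (X : SchemeOver ℂ)
    (D : UnitaryBallQuotientDatum (2 * (m + 1)) X) (h1 : 1 ≤ m) (h2 : m ≤ 2) :
    ∀ M : Submodule ℂ (complexBetti X (2 * (m + 1))),
      M ≤ Submodule.span ℂ (heckeKernel m X D) → M ≤ Submodule.span ℂ {x | x ∈ M ∧ IsRationalClass x} →
      (∀ g, ∀ x ∈ M, D.heckeCorrespondenceAction (2 * (m + 1)) g x ∈ M) → M ≠ ⊥ →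
      (∀ M' : Submodule ℂ (complexBetti X (2 * (m + 1))), M' ≤ M →
        M' ≤ Submodule.span ℂ {x | x ∈ M' ∧ IsRationalClass x} → (∀ g, ∀ x ∈ M', D.heckeCorrespondenceAction (2 * (m + 1)) g x ∈ M') → M' = ⊥ ∨ M' = M) →
      ∃ a ∈ algebraicClasses X (m + 1), ∃ x ∈ M, cupProduct (two_mul_add_two_mul (m + 1) (m + 1)) a x ≠ 0 := by
  sorry

/-! ### The composition -/

/-- **The line concludes the crux** (kernel-checked composition; its one hypothesis `CupProductAlgebraic`
is the route support stmt-HodgeConjecture-14350, as in the two earlier registered skeletons): S1 + S2 give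
`TWH(D) ≤ Alg`, S3 the adjoints, S5 HECKE-DETECT, S4 turns them into middle-degree HC for `D`, and the
crux instance follows because `c = P c` is a rational `(n,n)`-class (H3 at `β = c`; Disproof F1). The
logical shape is `S1 → S2 → S3 → S4 → S5 → IsotypicMiddleClassesAlgebraic`; sorries live only in `stub_*`. -/
theorem isotypicMiddleClassesAlgebraic_of (h9 : EndoscopicMiddleDegree.CupProductAlgebraic) :
    EndoscopicMiddleDegree.IsotypicMiddleClassesAlgebraic := by
  intro μ hμ m X D h1 h2 γ _hγ P _hPrat hPhodge c hc hPc
  have hTWH : heckeSaturatedThetaWorld m X D ≤ algebraicClasses X (m + 1) :=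
    stub_saturatedThetaWorldAlgebraic h9 μ hμ m X D h1 h2 (stub_lowDegreeHodge m X D h1 h2)
  exact stub_heckeKernelGeneration h9 m X D h1 h2 (stub_oneSeedPerHeckePiece m X D h1 h2) hTWH
    (stub_heckeAdjoint m X D h1 h2) c hc (hPc ▸ hPhodge c)

end Summit.HodgeConjecture.HodgeConjecture.Cruxes.IsotypicMiddleClassesAlgebraic.HeckeGeneration

end
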